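import Mathlib
import Summits.PneNP.PneNP.Theorems.Nc03AvoidResidualCoreReductionSolve6
import Summits.PneNP.PneNP.Theorems.Nc03AvoidResidualCoreReductionMuxB
import Summits.PneNP.PneNP.Theorems.Nc03AvoidResidualCoreReductionRankKit

/-!
# Route Nc03AvoidResidualCore, item `ResidualCoreReduction` — the solver, XV: class `12` (`MUX`)

Helper file for `stmt-PneNP-20227` (sequel of `…ReductionSolve6`, `…ReductionMuxB`; cell pnp-ideate).
The polynomial-time solver for the pure `MUX` class: the data multigraph's graph data `gd12`, the
packed part `P12P` (= `P12 J`), the columns of the certificate map `muxMap` as index lists, the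
support of a pattern, and the search over candidates `(e, b)` for one whose pattern's indicator is
outside the range of `muxMap` (a span test) — it exists when `5N < M` (`cert12_exists`) and is
outside the range of the instance (`cert12_sound'`). `sol12_correct`, `codeFP_sol12`.
-/

set_option linter.dupNamespace false -- `Summit.PneNP.PneNP.…`: summit = sub-problem name (D-0017 single-conjunct layout)

namespace Summit.PneNP.PneNP.Theorems.Nc03Reduction

open Literature.Computability.Complexity CodeFP

variable {N M : ℕ}

/-! ## Programs -/

/-- The graph data of the data multigraph: vertex `2a` for role `1`, `2b + 1` for role `2`. -/
def gd12 (pr : PRaw) : GD := (2 * pr.1, (enumT pr).map fun x => (x.1, 2 * x.2.2.1, 2 * x.2.2.2 + 1))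

/-- The packed part of the data multigraph. -/
def P12P (pr : PRaw) : List Bool := packUnionP (gd12 pr) (allP (gd12 pr))

/-- Column `v` of the certificate map: outputs of `P` with selector `v`, then those with `0`-datum `v`. -/
def col12 (pr : PRaw) (P : List Bool) (v : ℕ) : List ℕ :=
  (((enumT pr).filter fun x => P.getD x.1 false && decide (x.2.1 = v)).map fun x => x.1) ++
    (((enumT pr).filter fun x => P.getD x.1 false && decide (x.2.2.2 = v)).map fun x => x.1)

/-- All columns. -/
def cols12 (pr : PRaw) (P : List Bool) : List (List ℕ) := (List.range pr.1).map fun v => col12 pr P v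

/-- The support of a bit string over the outputs. -/
def suppP (gd : GD) (y : List Bool) : List ℕ := (List.range (mP gd)).filter fun j => y.getD j false

/-- The candidate test: non-forest edge of the packed part whose pattern escapes the range. -/
def test12 (pr : PRaw) (eb : ℕ × Bool) : Bool :=
  (P12P pr).getD eb.1 false && !inForestP (gd12 pr) (P12P pr) eb.1 &&
    !inSpan (mP (gd12 pr)) (cols12 pr (P12P pr)) (suppP (gd12 pr) (flipColP (gd12 pr) (P12P pr) eb.1 eb.2))

/-- The candidates `(e, b)`. -/
def cands12 (pr : PRaw) : List (ℕ × Bool) := (List.range (mP (gd12 pr))).product [false, true]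

/-- Solver, class `12`. -/
def sol12 (pr : PRaw) : List Bool :=
  ((cands12 pr).find? (test12 pr)).elim (zerosP (gd12 pr)) fun eb => flipColP (gd12 pr) (P12P pr) eb.1 eb.2

/-! ## Agreement and correctness -/

section Correct

variable (J : LocalMap 3 N M)

/-- **The program's graph data is the data multigraph's graph data.** -/
theorem gd12_rawOf : gd12 (rawOf J) = gdOf (G12 J) := by
  unfold gd12 gdOf
  rw [rawOf_N, enumT_rawOf, List.map_ofFn]
  rfl

/-- Members of the candidate list. -/
theorem mem_cands12 {e : ℕ} {b : Bool} : (e, b) ∈ cands12 (rawOf J) ↔ e < M := by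
  unfold cands12
  rw [gd12_rawOf, mP_gdOf, List.pair_mem_product, List.mem_range]
  constructor
  · exact fun h => h.1
  · intro h; exact ⟨h, by cases b <;> simp⟩

/-- Output length, class `12`. -/
theorem length_sol12 : (sol12 (rawOf J)).length = M := by
  unfold sol12
  rw [gd12_rawOf]
  cases (cands12 (rawOf J)).find? (test12 (rawOf J)) with
  | none => simp [zerosP, mP_gdOf]
  | some eb => exact length_flipColP _ _ _

/-- The support as a vector is the indicator. -/
theorem vecL_suppP {yl : List Bool} {y' : Fin M → Bool} (hy : ∀ j : Fin M, yl.getD j.val false = y' j) :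
    vecL M (suppP (gdOf (G12 J)) yl) = chiP y' := by
  funext j
  unfold vecL suppP
  rw [chiP_apply, mP_gdOf, ← hy j]
  by_cases hp : yl.getD j.val false = true
  · rw [List.count_filter (p := fun i => yl.getD i false) (by exact hp),
      List.count_eq_one_of_mem List.nodup_range (List.mem_range.2 j.isLt), if_pos hp]
    simp
  · have hz : ((List.range M).filter fun i => yl.getD i false).count j.val = 0 :=
      List.count_eq_zero.2 fun h => hp (List.mem_filter.1 h).2
    rw [hz, if_neg hp]
    simp

/-- The index list of the outputs of `P` passing a test on their triple has no duplicates, and its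
members are the passing outputs. -/
theorem count_idxFilter (q : ETrip → Bool) (j : Fin M) :
    (((enumT (rawOf J)).filter q).map fun x => x.1).count j.val = if q (j.val, tripOf J j) = true then 1 else 0 := by
  have hnd : (((enumT (rawOf J)).filter q).map fun x => x.1).Nodup := by
    rw [enumT_rawOf]
    refine List.Nodup.map_on ?_ (List.Nodup.filter _ ?_)
    · intro x hx y hy hxy
      obtain ⟨px, rfl⟩ := (mem_enumT_iff J).1 (by rw [enumT_rawOf]; exact (List.mem_filter.1 hx).1)
      obtain ⟨py, rfl⟩ := (mem_enumT_iff J).1 (by rw [enumT_rawOf]; exact (List.mem_filter.1 hy).1)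
      simp only at hxy
      rw [Fin.ext hxy]
    · rw [List.nodup_ofFn]
      intro a b h; simpa [Fin.ext_iff] using congrArg Prod.fst h
  rw [hnd.count]
  have hmem : j.val ∈ (((enumT (rawOf J)).filter q).map fun x => x.1) ↔ q (j.val, tripOf J j) = true := by
    rw [List.mem_map]
    constructor
    · rintro ⟨x, hx, hxj⟩
      obtain ⟨hx1, hx2⟩ := List.mem_filter.1 hx
      obtain ⟨p, rfl⟩ := (mem_enumT_iff J).1 hx1
      have : p = j := Fin.ext hxj
      subst this; exact hx2
    · intro h; exact ⟨(j.val, tripOf J j), List.mem_filter.2 ⟨mem_enumT J j, h⟩, rfl⟩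
  by_cases h : q (j.val, tripOf J j) = true
  · rw [if_pos (hmem.2 h), if_pos h]
  · rw [if_neg (fun hm => h (hmem.1 hm)), if_neg h]

/-- A column as a vector is the image of the corresponding unit vector under the certificate map. -/
theorem vecL_col12 {P : Finset (Fin M)} {PL : List Bool} (hP : RepE P PL) (v : Fin N) :
    vecL M (col12 (rawOf J) PL v.val) = muxMap J P (Pi.single v 1) := by
  funext j
  unfold vecL col12
  rw [List.count_append, count_idxFilter, count_idxFilter]
  simp only [muxMap, LinearMap.coe_mk, AddHom.coe_mk, Bool.and_eq_true, decide_eq_true_eq, tripOf_fst,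
    tripOf_snd_snd, hP j, Pi.single_apply, Fin.ext_iff]
  have h11 : (1 : ZMod 2) + 1 = 0 := by decide
  have h22 : (2 : ZMod 2) = 0 := by decide
  by_cases h0 : j ∈ P <;> by_cases h1 : (J.vars j 0).val = v.val <;> by_cases h2 : (J.vars j 2).val = v.val <;>
    simp [h0, h1, h2, h11, h22]

/-- The columns span the range of the certificate map. -/
theorem span_cols12 {P : Finset (Fin M)} {PL : List Bool} (hP : RepE P PL) :
    Submodule.span (ZMod 2) (vecL M '' {c | c ∈ cols12 (rawOf J) PL}) = LinearMap.range (muxMap J P) := by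
  have hset : vecL M '' {c | c ∈ cols12 (rawOf J) PL} = Set.range (fun v : Fin N => muxMap J P (Pi.single v 1)) := by
    ext u
    unfold cols12
    simp only [Set.mem_image, Set.mem_setOf_eq, List.mem_map, List.mem_range, Set.mem_range, rawOf_N]
    constructor
    · rintro ⟨c, ⟨v, hv, rfl⟩, rfl⟩; exact ⟨⟨v, hv⟩, (vecL_col12 J hP ⟨v, hv⟩).symm⟩
    · rintro ⟨v, rfl⟩; exact ⟨_, ⟨v.val, v.isLt, rfl⟩, vecL_col12 J hP v⟩
  have hrange : Set.range (fun v : Fin N => muxMap J P (Pi.single v 1)) =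
      muxMap J P '' Set.range (fun v : Fin N => (Pi.basisFun (ZMod 2) (Fin N)) v) := by
    rw [← Set.range_comp]
    congr 1
    funext v
    simp [Pi.basisFun_apply]
  rw [hset, hrange, Submodule.span_image, (Pi.basisFun (ZMod 2) (Fin N)).span_eq, Submodule.map_top]

variable [NeZero M]

/-- **The packed part bit string represents `P12`.** -/
theorem P12P_rep : RepE (P12 J) (P12P (rawOf J)) := by
  unfold P12P P12
  rw [gd12_rawOf]
  exact packUnionP_rep (allP_rep' (G12 J))
where
  /-- all-ones represents everything (for any graph data of `M` edges) -/
  allP_rep' : ∀ (G : Bip (Fin M) (Fin (2 * N))), RepE (Finset.univ : Finset (Fin M)) (allP (gdOf G)) := by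
    intro G j; unfold allP; rw [getD_map_range]; simp

/-- Reading the candidate test. -/
theorem test12_iff (e : Fin M) (b : Bool) :
    test12 (rawOf J) (e.val, b) = true ↔
      e ∈ P12 J ∧ e ∉ (G12 J).forest (P12 J) ∧
        chiP ((G12 J).flipCol (P12 J) e b) ∉ LinearMap.range (muxMap J (P12 J)) := by
  have hP := P12P_rep J
  unfold test12
  rw [Bool.and_eq_true, Bool.and_eq_true, Bool.not_eq_true', Bool.not_eq_true', hP e, decide_eq_true_eq, gd12_rawOf,
    Bool.eq_false_iff, ne_eq, inForestP_iff hP, Bool.eq_false_iff, ne_eq, inSpan_iff, mP_gdOf, span_cols12 J hP]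
  constructor
  · rintro ⟨⟨he, hf⟩, hb⟩
    refine ⟨he, hf, ?_⟩
    rwa [vecL_suppP J (fun j => flipColP_eq hP he b j)] at hb
  · rintro ⟨he, hf, hb⟩
    refine ⟨⟨he, hf⟩, ?_⟩
    rwa [vecL_suppP J (fun j => flipColP_eq hP he b j)]

/-- **Correctness, class `12`.** -/
theorem sol12_correct (hP : J.IsPure (rep 12)) (hM : 5 * N < M) :
    (fun p : Fin M => (sol12 (rawOf J)).getD p.val false) ∉ J.range := by
  obtain ⟨e, heP, heT, b, hb⟩ := cert12_exists J hM
  have hx₀ : test12 (rawOf J) (e.val, b) = true := (test12_iff J e b).2 ⟨heP, heT, hb⟩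
  have hmem : (e.val, b) ∈ cands12 (rawOf J) := (mem_cands12 J).2 e.isLt
  cases h : (cands12 (rawOf J)).find? (test12 (rawOf J)) with
  | none => exact absurd hx₀ (by have := List.find?_eq_none.1 h _ hmem; simpa using this)
  | some eb =>
    obtain ⟨e', b'⟩ := eb
    have hx := List.find?_some h
    have he' : e' < M := (mem_cands12 J).1 (List.mem_of_find?_eq_some h)
    obtain ⟨heP', heT', hb'⟩ := (test12_iff J ⟨e', he'⟩ b').1 hx
    have hsol : sol12 (rawOf J) = flipColP (gdOf (G12 J)) (P12P (rawOf J)) e' b' := by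
      unfold sol12; rw [h, gd12_rawOf]; rfl
    have hfun : (fun p : Fin M => (sol12 (rawOf J)).getD p.val false) = (G12 J).flipCol (P12 J) ⟨e', he'⟩ b' := by
      funext p; rw [hsol]; exact flipColP_eq (P12P_rep J) heP' b' p
    rw [hfun]
    exact cert12_sound' hP heP' heT' b' hb'

end Correct

/-! ## Polynomial time -/

/-- The graph data is polynomial time. -/
theorem codeFP_gd12 : CodeFP prE gdE gd12 := by
  have hitem : CodeFP etE tripE (fun x : ETrip => (x.1, 2 * x.2.2.1, 2 * x.2.2.2 + 1)) :=
    ((fst _ _).pair (((natMul.comp ((const _ 2).pair (snd _ _).snd'.fst')).pair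
      (natAdd.comp ((natMul.comp ((const _ 2).pair (snd _ _).snd'.snd')).pair (const _ 1)))))).congr fun _ => rfl
  exact (((unMulConst 2).comp codeFP_N).pair ((map₀ hitem).comp codeFP_enumT)).congr fun _ => rfl

/-- The packed part is polynomial time. -/
theorem codeFP_P12P : CodeFP prE strE P12P :=
  (codeFP_packUnionP.comp (codeFP_gd12.pair (codeFP_allP.comp codeFP_gd12))).congr fun _ => rfl

/-- A column is polynomial time. -/
theorem codeFP_col12 : CodeFP (pairE prE (pairE strE natE)) (rawE natE) (fun q => col12 q.1 q.2.1 q.2.2) := by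
  have hp1 : CodeFP (pairE (pairE prE (pairE strE natE)) etE) bitE
      (fun y => y.1.2.1.getD y.2.1 false && decide (y.2.2.1 = y.1.2.2)) :=
    ((strGetDNat.comp ((fst _ _).snd'.fst'.pair (snd _ _).fst')).and
      (codeFP_eqTest (snd _ _).snd'.fst' (fst _ _).snd'.snd')).congr fun _ => rfl
  have hp2 : CodeFP (pairE (pairE prE (pairE strE natE)) etE) bitE
      (fun y => y.1.2.1.getD y.2.1 false && decide (y.2.2.2.2 = y.1.2.2)) :=
    ((strGetDNat.comp ((fst _ _).snd'.fst'.pair (snd _ _).fst')).and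
      (codeFP_eqTest (snd _ _).snd'.snd'.snd' (fst _ _).snd'.snd')).congr fun _ => rfl
  have hl : CodeFP (pairE prE (pairE strE natE)) (rawE etE) (fun q => enumT q.1) := codeFP_enumT.comp (fst _ _)
  have h1 := (map₀ (fst natE tripE)).comp ((filter hp1).comp ((CodeFP.id _).pair hl))
  have h2 := (map₀ (fst natE tripE)).comp ((filter hp2).comp ((CodeFP.id _).pair hl))
  exact ((rawAppend natE).comp (h1.pair h2)).congr fun _ => rfl

/-- All columns are polynomial time. -/
theorem codeFP_cols12 : CodeFP (pairE prE strE) (rawE (rawE natE)) (fun q => cols12 q.1 q.2) := by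
  have hi : CodeFP (pairE (pairE prE strE) natE) (rawE natE) (fun y => col12 y.1.1 y.1.2 y.2) :=
    (codeFP_col12.comp ((fst _ _).fst'.pair ((fst _ _).snd'.pair (snd _ _)))).congr fun _ => rfl
  exact ((map hi).comp ((CodeFP.id _).pair (urange.comp (codeFP_N.comp (fst _ _))))).congr fun _ => rfl

/-- The support is polynomial time. -/
theorem codeFP_suppP : CodeFP (pairE gdE strE) (rawE natE) (fun q => suppP q.1 q.2) := by
  have hp : CodeFP (pairE (pairE gdE strE) natE) bitE (fun y => y.1.2.getD y.2 false) :=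
    strGetDNat.comp ((fst _ _).snd'.pair (snd _ _))
  exact ((filter hp).comp ((CodeFP.id _).pair (urange.comp (codeFP_mP.comp (fst _ _))))).congr fun _ => rfl

/-- The candidate test is polynomial time. -/
theorem codeFP_test12 : CodeFP (pairE prE (pairE natE bitE)) bitE (fun q => test12 q.1 q.2) := by
  have hgd : CodeFP (pairE prE (pairE natE bitE)) gdE (fun q => gd12 q.1) := codeFP_gd12.comp (fst _ _)
  have hP : CodeFP (pairE prE (pairE natE bitE)) strE (fun q => P12P q.1) := codeFP_P12P.comp (fst _ _)
  have hce : CodeFP (pairE prE (pairE natE bitE)) ceE (fun q => (gd12 q.1, P12P q.1)) := hgd.pair hP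
  have h1 : CodeFP (pairE prE (pairE natE bitE)) bitE (fun q => (P12P q.1).getD q.2.1 false) :=
    (strGetDNat.comp (hP.pair (snd _ _).fst')).congr fun _ => rfl
  have h2 : CodeFP (pairE prE (pairE natE bitE)) bitE (fun q => inForestP (gd12 q.1) (P12P q.1) q.2.1) :=
    (codeFP_inForestP.comp (hce.pair (snd _ _).fst')).congr fun _ => rfl
  have hy : CodeFP (pairE prE (pairE natE bitE)) strE (fun q => flipColP (gd12 q.1) (P12P q.1) q.2.1 q.2.2) :=
    (codeFP_flipColP.comp ((hce.pair (snd _ _).fst').pair (snd _ _).snd')).congr fun _ => rfl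
  have hsupp : CodeFP (pairE prE (pairE natE bitE)) (rawE natE)
      (fun q => suppP (gd12 q.1) (flipColP (gd12 q.1) (P12P q.1) q.2.1 q.2.2)) :=
    (codeFP_suppP.comp (hgd.pair hy)).congr fun _ => rfl
  have hcols : CodeFP (pairE prE (pairE natE bitE)) (rawE (rawE natE)) (fun q => cols12 q.1 (P12P q.1)) :=
    (codeFP_cols12.comp ((fst _ _).pair hP)).congr fun _ => rfl
  have h3 : CodeFP (pairE prE (pairE natE bitE)) bitE
      (fun q => inSpan (mP (gd12 q.1)) (cols12 q.1 (P12P q.1)) (suppP (gd12 q.1) (flipColP (gd12 q.1) (P12P q.1) q.2.1 q.2.2))) :=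
    (codeFP_inSpan.comp ((codeFP_mP.comp hgd).pair (hcols.pair hsupp))).congr fun _ => rfl
  exact ((h1.and h2.not).and h3.not).congr fun _ => rfl

/-- The candidate list is polynomial time. -/
theorem codeFP_cands12 : CodeFP prE (rawE (pairE natE bitE)) cands12 :=
  ((rawProduct natE bitE).comp ((urange.comp (codeFP_mP.comp codeFP_gd12)).pair
    (const _ [false, true]))).congr fun _ => rfl

/-- **Polynomial time, class `12`.** -/
theorem codeFP_sol12 : CodeFP prE (rawE bitE) sol12 := by
  have hfind : CodeFP prE (optE (pairE natE bitE)) (fun pr => (cands12 pr).find? (test12 pr)) :=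
    ((rawFind? (σ := PRaw) (eσ := prE) (p := fun q => test12 q.1 q.2) codeFP_test12).comp
      ((CodeFP.id _).pair codeFP_cands12)).congr fun _ => rfl
  have hsome : CodeFP (pairE prE (pairE natE bitE)) strE (fun q => flipColP (gd12 q.1) (P12P q.1) q.2.1 q.2.2) :=
    (codeFP_flipColP.comp ((((codeFP_gd12.comp (fst _ _)).pair (codeFP_P12P.comp (fst _ _))).pair
      (snd _ _).fst').pair (snd _ _).snd')).congr fun _ => rfl
  have hk := optCases (σ := PRaw) (eσ := prE) (eα := pairE natE bitE) (eδ := strE)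
    (k := fun pr o => o.elim (zerosP (gd12 pr)) fun eb => flipColP (gd12 pr) (P12P pr) eb.1 eb.2)
    (gnone := fun pr => zerosP (gd12 pr)) (gsome := fun q => flipColP (gd12 q.1) (P12P q.1) q.2.1 q.2.2)
    (codeFP_zerosP.comp codeFP_gd12) hsome (fun _ => rfl) (fun _ _ => rfl)
  have h : CodeFP prE strE sol12 := (hk.comp ((CodeFP.id prE).pair hfind)).congr (fun pr => by unfold sol12; rfl)
  exact (IoHard.codeFP_strToRaw.comp h).congr fun _ => rfl

end Summit.PneNP.PneNP.Theorems.Nc03Reduction
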